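import Mathlib

/-!
# Fourier–Mukai letter law — MINT block B4 «alphabet FM» (hsemireg-alphabet-fm-1 g0/g1, 2026-08-29)

Crux of record: `Summit.HodgeConjecture.HodgeConjecture.Theses.EightfoldBlochSeeds.BlochSeedDiscOne`
(item stmt-HodgeConjecture-18881; skeleton `Lines/birth.lean`, STUB R `stub_rung_pad4_seedAt` — UNTOUCHED here).
Nothing in this file proves HC, HC_AV, HC_CM, H2, №4/26512 or item 18881: it is the CLASS-LEVEL (cohomological)
shadow of the Fourier–Mukai transform `Φ = Φ_𝒫` on the LINE letter alphabets of the cell, typed so that the B4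
dictionary of the memos `FM-ALPHABET-LINE14-fm1-g0.md` (17bf9bc1e4d7fd2b) and `FM-ALPHABET-RB-ROOM-fm1-g1.md` is a
kernel fact and not a pencil line.  Mathlib only; no `sorry`; no instances, no notation.

## Dictionary (per factor `S_f = E × E`, frame `⟨1, I, e, ē, pt⟩`, `I² = 2·pt`, `e·ē = −pt`, all other products of
two degree-2 letters zero)

* a letter `x = a·I + b·e + b'·ē` has `x²/2 = χ·pt`, `χ = a² − b·b'` (`= a² − |β|²` on shell `b' = b̄`), so
  `ch(L_x) = exp x = 1 + x + χ·pt` (`Frame.exp`);  `exp x · exp y = exp (x + y)` (`Frame.exp_add`).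
* the cohomological FM transform acts on the frame by `1 ↦ pt`, `pt ↦ 1`, `I ↦ −I`, `e ↦ εe`, `ē ↦ εē`
  (`Frame.fm ε`, `ε = ±1` a convention sign; Mukai 1981, Birkenhake–Lange CAV §14 / Lange–Birkenhake 1992 §6:
  Lemma 6.1.9, Thm 6.1.10, Cor 6.2.16, Prop 6.2.20/21): `fm ∘ fm = id` (`Frame.fm_fm`), and
  **`fm (exp x) = χ • exp x̂`, `x̂ = (−a·I + ε b·e + ε b'·ē)/χ`** (`Frame.fm_exp_eq_smul`): the transform of a
  non-degenerate letter is `rank |χ|` times the Chern character of slope `x̂` — a simple semi-homogeneous bundle.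
* `fm (exp (t·I)) = t² • exp (−I/t)` per factor (`Frame.fm_expI`), i.e. `F(e^{tH}) = t⁸ e^{−H/t}` on `X = S⁴`.
* LINE law: a LINE-`n` letter is `a = n − c` with level `c` (`c² = b b'` on shell); the normalising twist gives
  `exp(−n·I)·exp x = 1 + y`, `y = −c·I + b·e + b'·ē` null (`Frame.twist_normalForm`, `Frame.normalForm_null`), and on
  the dual side `exp(I/n)·exp x̂ = 1 + ŷ` with **`ŷ = (−c·I + εb·e + εb'·ē)/χ`** (`Frame.dual_normalForm`):
  null coordinates scale by `1/χ_f`, the dual letter lies on **LINE `−1/n`** in the signed sense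
  (`dualSlope_signed : −a/χ + c/χ = −1/(a + c)`); in the cell's unsigned convention `(a, |β|)` this reads LINE `−1/n`
  exactly when `χ > 0` (IT₀/IT₂ letters: the whole cell range `c < n/2`, and all of LINE `≤ −1`;
  `dualSlope_abs_of_pos`) and slope-sum `−n/χ` for IT₁ letters (`χ < 0`, met on LINE `1`; `dualSlope_abs_of_neg`).
* DESIGN level (`Design K = List (multiplicity × cell)`, a cell = one letter per factor `f : Fin 4`):
  `rank = Σ m`, `χ = Σ m·R`, `R = Π_f χ_f`, Weil coordinate `μ = Σ m·Π_f b_f`, `μ̄ = Σ m·Π_f b'_f`;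
  the transform of a `WIT_j` design (`s = (−1)^j`) is `m ↦ s·m·R(x)`, `x ↦ x̂` (`Design.fm s ε`), and
  **`rank(D̂) = s·χ(D)`, `χ(D̂) = s·rank(D)`, `μ(D̂) = s·ε⁴·μ(D)`, `μ̄(D̂) = s·ε⁴·μ̄(D)`**
  (`Design.rank_fm`, `Design.chi_fm`, `Design.mu_fm`, `Design.muBar_fm`): `|μ̂| = |μ|`, `μ̂ ≠ 0 ↔ μ ≠ 0`
  (`Design.mu_fm_ne_zero_iff`).
* LINE arithmetic: for a clean LINE-`n` class `γ − κH + μe⁴ + μ̄ē⁴`, `χ(G((n' − n)H)) = n'⁷(γn' − 8κ)`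
  (`chiLine`); with `γn' − 8κ ∈ ℤ ∖ 0` an FM partner of rank `< 128` forces `|n'| ≤ 1` (`abs_le_one_of_chiLine_lt`);
  worked example ac808a66 (`γ = 4`, `κ = 1704`, `μ = −13824 i`): `χ(𝓔(tH)) = (14+t)⁷(4(14+t) − 13632) ≤ 0` for
  `−14 ≤ t ≤ 3394` and `= 4·3409⁷ = 21401735871485861713275076` at `t = 3395` (`chiLine_ac808a66_*`).
* Degree reflection: ch-degree `p ↦ 8 − p`, σ-form-degree `k ↦ 6 − k` (Hodge `(p,q) ↦ (8−q, 8−p)`); the door slot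
  `p = 4` / form degree `3` is the unique fixed point (`fmDegree_fixed_iff`, `fmFormDegree_fixed_iff`).

Labels: the algebra is [std]; that `Φ` is a SYMMETRY of every LINE road (presentations, Hom/Ext tables, (B1♯)/Hall
data transported verbatim) is [std, exact autoequivalence]; nothing here is an instrument run or a census row.
-/

namespace Summit.HodgeConjecture.HodgeConjecture.Cruxes.BlochSeedDiscOne.FourierMukaiLetterLaw

/-! ## Part A — the per-factor frame algebra `⟨1, I, e, ē, pt⟩` -/

/-- An element `s·1 + l·I + e·e + eb·ē + p·pt` of the even cohomology frame of one factor `S_f`. -/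
@[ext]
structure Frame (K : Type*) where
  /-- coefficient of `1` (degree 0) -/
  s : K
  /-- coefficient of `I` (degree 2) -/
  l : K
  /-- coefficient of `e` (degree 2, holomorphic Weil letter) -/
  e : K
  /-- coefficient of `ē` (degree 2, anti-holomorphic Weil letter) -/
  eb : K
  /-- coefficient of `pt` (degree 4) -/
  p : K

namespace Frame

variable {K : Type*} [Field K]

/-- The product in the truncated frame algebra: `I² = 2·pt`, `e·ē = ē·e = −pt`, `e² = ē² = I·e = I·ē = 0`. -/
def mul (x y : Frame K) : Frame K :=
  ⟨x.s * y.s, x.s * y.l + x.l * y.s, x.s * y.e + x.e * y.s, x.s * y.eb + x.eb * y.s,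
    x.s * y.p + x.p * y.s + 2 * x.l * y.l - (x.e * y.eb + x.eb * y.e)⟩

/-- Scalar multiple. -/
def smul (r : K) (x : Frame K) : Frame K := ⟨r * x.s, r * x.l, r * x.e, r * x.eb, r * x.p⟩

/-- The unit `1`. -/
def one : Frame K := ⟨1, 0, 0, 0, 0⟩

/-- `exp x = ch(L_x)` for the letter `x = a·I + b·e + b'·ē`: `1 + x + (a² − b b')·pt`. -/
def exp (a b b' : K) : Frame K := ⟨1, a, b, b', a ^ 2 - b * b'⟩

/-- The cohomological Fourier–Mukai transform on one factor: `1 ↦ pt`, `pt ↦ 1`, `I ↦ −I`, `e ↦ εe`, `ē ↦ εē`. -/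
def fm (ε : K) (x : Frame K) : Frame K := ⟨x.p, -x.l, ε * x.e, ε * x.eb, x.s⟩

theorem mul_comm' (x y : Frame K) : mul x y = mul y x := by
  ext <;> simp only [mul] <;> ring

theorem mul_assoc' (x y z : Frame K) : mul (mul x y) z = mul x (mul y z) := by
  ext <;> simp only [mul] <;> ring

theorem one_mul' (x : Frame K) : mul one x = x := by
  ext <;> simp [mul, one]

/-- `x²/2 = χ·pt`: the square of a letter is `2(a² − b b')·pt`. -/
theorem letter_sq (a b b' : K) :
    mul ⟨0, a, b, b', 0⟩ ⟨0, a, b, b', 0⟩ = ⟨0, 0, 0, 0, 2 * (a ^ 2 - b * b')⟩ := by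
  ext <;> simp only [mul] <;> ring

/-- `exp x · exp y = exp (x + y)` (tensor product of line bundles). -/
theorem exp_add (a b b' a₁ b₁ b₁' : K) :
    mul (exp a b b') (exp a₁ b₁ b₁') = exp (a + a₁) (b + b₁) (b' + b₁') := by
  ext <;> simp only [mul, exp] <;> ring

theorem exp_zero : exp (0 : K) 0 0 = one := by
  ext <;> simp [exp, one]

/-- `fm` is an involution (Mukai inversion at class level; `(−1)^g = 1` for `g = 8`, per factor `g = 2`). -/
theorem fm_fm {ε : K} (hε : ε ^ 2 = 1) (x : Frame K) : fm ε (fm ε x) = x := by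
  have h2 : ε * ε = 1 := by rw [← sq]; exact hε
  ext <;> simp [fm, ← mul_assoc, h2]

/-- The transform of `ch(L_x)`: `χ·1 − a·I + εb·e + εb'·ē + pt`. -/
theorem fm_exp (ε a b b' : K) : fm ε (exp a b b') = ⟨a ^ 2 - b * b', -a, ε * b, ε * b', 1⟩ := by
  ext <;> simp [fm, exp]

/-- The dual letter has `χ̂ = 1/χ` (so `R(x̂) = 1/R(x)` cellwise). -/
theorem chi_dual {ε : K} (hε : ε ^ 2 = 1) {a b b' : K} (hχ : a ^ 2 - b * b' ≠ 0) :
    (-a / (a ^ 2 - b * b')) ^ 2 - (ε * b / (a ^ 2 - b * b')) * (ε * b' / (a ^ 2 - b * b')) =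
      (a ^ 2 - b * b')⁻¹ := by
  rw [div_pow, div_mul_div_comm, sq (a ^ 2 - b * b'), ← sub_div,
    div_eq_iff (mul_ne_zero hχ hχ), inv_mul_cancel_left₀ hχ]
  linear_combination (-(b * b')) * hε

/-- **Letter law.** For a non-degenerate letter (`χ = a² − b b' ≠ 0`) the transform is `χ • exp x̂` with
`x̂ = (−a·I + εb·e + εb'·ē)/χ`: rank `|χ|` times the Chern character of a simple semi-homogeneous bundle. -/
theorem fm_exp_eq_smul {ε : K} (hε : ε ^ 2 = 1) {a b b' : K} (hχ : a ^ 2 - b * b' ≠ 0) :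
    fm ε (exp a b b') =
      smul (a ^ 2 - b * b')
        (exp (-a / (a ^ 2 - b * b')) (ε * b / (a ^ 2 - b * b')) (ε * b' / (a ^ 2 - b * b'))) := by
  ext
  · simp only [fm, exp, smul, mul_one]
  · simp only [fm, exp, smul]; rw [mul_div_assoc', mul_div_cancel_left₀ _ hχ]
  · simp only [fm, exp, smul]; rw [mul_div_assoc', mul_div_cancel_left₀ _ hχ]
  · simp only [fm, exp, smul]; rw [mul_div_assoc', mul_div_cancel_left₀ _ hχ]
  · simp only [fm, exp, smul]; rw [chi_dual hε hχ, mul_inv_cancel₀ hχ]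

/-- `F(e^{tI}) = t²·e^{−I/t}` per factor, hence `F(e^{tH}) = t⁸ e^{−H/t}` on `X = S⁴`
(so `F(Hᵏ) = (−1)ᵏ k!/(8−k)! · H^{8−k}`: ch-degree `k ↦ 8 − k`). -/
theorem fm_expI (ε : K) {t : K} (ht : t ≠ 0) :
    fm ε (exp t 0 0) = smul (t ^ 2) (exp (-1 / t) 0 0) := by
  ext <;> simp only [fm, exp, smul] <;> first | ring1 | (field_simp <;> ring1)

/-! ### LINE law: normal forms and dual slopes -/

/-- Normalising twist of a LINE-`n` letter `a = n − c`: `exp(−n·I)·exp x = exp y`, `y = −c·I + b·e + b'·ē`. -/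
theorem twist_normalForm (n c b b' : K) :
    mul (exp (-n) 0 0) (exp (n - c) b b') = exp (-c) b b' := by
  rw [exp_add]; congr 1 <;> ring

/-- `y = −c·I + b·e + b'·ē` is null (`exp y = 1 + y`) exactly on shell `c² = b b'`. -/
theorem normalForm_null (c b b' : K) : (exp (-c) b b').p = 0 ↔ c ^ 2 = b * b' := by
  simp only [exp]; constructor <;> intro h <;> linear_combination h

/-- **Dual normal form.** On LINE `n` (`a = n − c`, `χ = a² − c²` with `c² = b b'`, `n ≠ 0`, `χ ≠ 0`) the dual
letter `x̂ = (−a, εb, εb')/χ` twisted by `exp(I/n)` is `exp ŷ` with `ŷ = (−c·I + εb·e + εb'·ē)/χ`: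
the null coordinates scale by `1/χ`, i.e. the dual letter lies on LINE `−1/n`. -/
theorem dual_normalForm (ε : K) {n c b b' : K} (hn : n ≠ 0) (hshell : c ^ 2 = b * b')
    (hχ : (n - c) ^ 2 - b * b' ≠ 0) :
    mul (exp (1 / n) 0 0)
        (exp (-(n - c) / ((n - c) ^ 2 - b * b')) (ε * b / ((n - c) ^ 2 - b * b'))
          (ε * b' / ((n - c) ^ 2 - b * b'))) =
      exp (-c / ((n - c) ^ 2 - b * b')) (ε * b / ((n - c) ^ 2 - b * b'))
        (ε * b' / ((n - c) ^ 2 - b * b')) := by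
  have hχ' : (n - c) ^ 2 - b * b' = n * (n - 2 * c) := by linear_combination hshell
  have hn2 : n - 2 * c ≠ 0 := by
    intro h; apply hχ; rw [hχ', h, mul_zero]
  rw [exp_add]
  congr 1
  · rw [hχ', div_add_div _ _ hn (mul_ne_zero hn hn2),
      div_eq_div_iff (mul_ne_zero hn (mul_ne_zero hn hn2)) (mul_ne_zero hn hn2)]
    ring
  · ring
  · ring

/-- Signed dual slope sum: `â + ĉ = −a/χ + c/χ = −1/(a + c) = −1/n`. -/
theorem dualSlope_signed {a c : K} (hsum : a + c ≠ 0) (hdiff : a - c ≠ 0) :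
    -a / (a ^ 2 - c ^ 2) + c / (a ^ 2 - c ^ 2) = -1 / (a + c) := by
  have hχ : a ^ 2 - c ^ 2 ≠ 0 := by
    rw [sq_sub_sq]; exact mul_ne_zero hsum hdiff
  field_simp
  ring

/-- Unsigned convention, `χ > 0` (IT₀ / IT₂ letters): `â + |ĉ| = −1/(a + c)` — LINE `n ↦` LINE `−1/n`. -/
theorem dualSlope_abs_of_pos {K : Type*} [Field K] [LinearOrder K] [IsStrictOrderedRing K] {a c : K} (hc : 0 ≤ c)
    (hχ : 0 < a ^ 2 - c ^ 2) :
    -a / (a ^ 2 - c ^ 2) + |c / (a ^ 2 - c ^ 2)| = -1 / (a + c) := by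
  have hsum : a + c ≠ 0 := by
    intro h
    have : a ^ 2 - c ^ 2 = 0 := by rw [sq_sub_sq, h, zero_mul]
    exact hχ.ne' this
  rw [abs_of_nonneg (div_nonneg hc hχ.le)]
  have hχ0 : a ^ 2 - c ^ 2 ≠ 0 := hχ.ne'
  have hdiff : a - c ≠ 0 := by
    intro h
    have : a ^ 2 - c ^ 2 = 0 := by rw [sq_sub_sq, h, mul_zero]
    exact hχ0 this
  field_simp
  ring

/-- Unsigned convention, `χ < 0` (IT₁ letters, LINE `1 ≤ n < 2c`): `â + |ĉ| = −(a + c)/χ`, NOT `−1/n` —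
the LINE-`1` partners of a design are not on one LINE. -/
theorem dualSlope_abs_of_neg {K : Type*} [Field K] [LinearOrder K] [IsStrictOrderedRing K] {a c : K} (hc : 0 ≤ c)
    (hχ : a ^ 2 - c ^ 2 < 0) :
    -a / (a ^ 2 - c ^ 2) + |c / (a ^ 2 - c ^ 2)| = -(a + c) / (a ^ 2 - c ^ 2) := by
  rw [abs_of_nonpos (div_nonpos_of_nonneg_of_nonpos hc hχ.le)]
  ring

end Frame

/-! ## Part B — designs: rank ↔ χ swap and `μ̂ = s·ε⁴·μ` -/

section Design

variable {K : Type*} [Field K]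

/-- A letter `(a, b, b')`: coefficients of `I`, `e`, `ē`. -/
abbrev Letter (K : Type*) := K × K × K

/-- A cell: one letter per factor. -/
abbrev Cell (K : Type*) := Fin 4 → Letter K

/-- A (virtual) design: a finite list of cells with multiplicities `m ∈ K` (integers in practice). -/
abbrev Design (K : Type*) := List (K × Cell K)

/-- `χ_f = a² − b b'` of a letter. -/
def Letter.chi (x : Letter K) : K := x.1 ^ 2 - x.2.1 * x.2.2

/-- The dual letter `x̂ = (−a, εb, εb')/χ`. -/
def Letter.fm (ε : K) (x : Letter K) : Letter K :=
  (-x.1 / Letter.chi x, ε * x.2.1 / Letter.chi x, ε * x.2.2 / Letter.chi x)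

/-- `R(x) = Π_f χ_f(x) = χ(⊠_f L_{x_f})`. -/
def Cell.R (x : Cell K) : K := ∏ f, Letter.chi (x f)

/-- Coefficient of the Weil word `e₀e₁e₂e₃` in `ch` of the cell: `Π_f b_f`. -/
def Cell.top (x : Cell K) : K := ∏ f, (x f).2.1

/-- Coefficient of `ē₀ē₁ē₂ē₃`: `Π_f b'_f`. -/
def Cell.topBar (x : Cell K) : K := ∏ f, (x f).2.2

/-- The dual cell. -/
def Cell.fm (ε : K) (x : Cell K) : Cell K := fun f => Letter.fm ε (x f)

-- A cell is NON-DEGENERATE (a complex of IT cells) iff every factor letter has `χ_f ≠ 0` (no apex letter);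
-- below this is always the inline hypothesis `∀ f, Letter.chi (x f) ≠ 0`.

/-- rank `γ = Σ m`. -/
def Design.rank (D : Design K) : K := (D.map fun mx => mx.1).sum

/-- Euler characteristic `χ = Σ m·R`. -/
def Design.chi (D : Design K) : K := (D.map fun mx => mx.1 * Cell.R mx.2).sum

/-- Weil coordinate `μ = Σ m·Π_f b_f`. -/
def Design.mu (D : Design K) : K := (D.map fun mx => mx.1 * Cell.top mx.2).sum

/-- Conjugate Weil coordinate `μ̄ = Σ m·Π_f b'_f`. -/
def Design.muBar (D : Design K) : K := (D.map fun mx => mx.1 * Cell.topBar mx.2).sum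

/-- The class-level FM transform of a `WIT_j` design (`s = (−1)^j`): `m ↦ s·m·R(x)`, `x ↦ x̂`. -/
def Design.fm (s ε : K) (D : Design K) : Design K :=
  D.map fun mx => (s * mx.1 * Cell.R mx.2, Cell.fm ε mx.2)

theorem Letter.chi_fm {ε : K} (hε : ε ^ 2 = 1) {x : Letter K} (hx : Letter.chi x ≠ 0) :
    Letter.chi (Letter.fm ε x) = (Letter.chi x)⁻¹ := by
  obtain ⟨a, b, b'⟩ := x
  simp only [Letter.chi, Letter.fm] at hx ⊢
  exact Frame.chi_dual hε hx

theorem Cell.R_fm {ε : K} (hε : ε ^ 2 = 1) {x : Cell K} (hx : ∀ f, Letter.chi (x f) ≠ 0) :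
    Cell.R (Cell.fm ε x) = (Cell.R x)⁻¹ := by
  simp only [Cell.R, Cell.fm]
  rw [← Finset.prod_inv_distrib]
  exact Finset.prod_congr rfl fun f _ => Letter.chi_fm hε (hx f)

theorem Cell.R_ne_zero {x : Cell K} (hx : ∀ f, Letter.chi (x f) ≠ 0) : Cell.R x ≠ 0 :=
  Finset.prod_ne_zero_iff.mpr fun f _ => hx f

theorem Cell.top_fm (ε : K) (x : Cell K) :
    Cell.top (Cell.fm ε x) = ε ^ 4 * Cell.top x / Cell.R x := by
  simp only [Cell.top, Cell.fm, Letter.fm, Cell.R]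
  rw [Finset.prod_div_distrib, Finset.prod_mul_distrib, Finset.prod_const, Finset.card_univ,
    Fintype.card_fin]

theorem Cell.topBar_fm (ε : K) (x : Cell K) :
    Cell.topBar (Cell.fm ε x) = ε ^ 4 * Cell.topBar x / Cell.R x := by
  simp only [Cell.topBar, Cell.fm, Letter.fm, Cell.R]
  rw [Finset.prod_div_distrib, Finset.prod_mul_distrib, Finset.prod_const, Finset.card_univ,
    Fintype.card_fin]

/-- **rank of the transform = `s·χ`.** -/
theorem Design.rank_fm (s ε : K) (D : Design K) :
    Design.rank (Design.fm s ε D) = s * Design.chi D := by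
  simp only [Design.rank, Design.fm, Design.chi, List.map_map, Function.comp_def]
  rw [← List.sum_map_mul_left]
  congr 1
  exact List.map_congr_left fun mx _ => by ring

/-- **χ of the transform = `s·rank`** (every cell non-degenerate, i.e. the design is a complex of IT cells). -/
theorem Design.chi_fm {s ε : K} (hε : ε ^ 2 = 1) {D : Design K} (hD : ∀ mx ∈ D, ∀ f, Letter.chi (mx.2 f) ≠ 0) :
    Design.chi (Design.fm s ε D) = s * Design.rank D := by
  simp only [Design.rank, Design.fm, Design.chi, List.map_map, Function.comp_def]
  rw [← List.sum_map_mul_left]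
  congr 1
  refine List.map_congr_left fun mx hmx => ?_
  rw [Cell.R_fm hε (hD mx hmx), mul_inv_cancel_right₀ (Cell.R_ne_zero (hD mx hmx))]

/-- **Weil coordinate of the transform: `μ̂ = s·ε⁴·μ`** (so `|μ̂| = |μ|`). -/
theorem Design.mu_fm (s ε : K) {D : Design K} (hD : ∀ mx ∈ D, ∀ f, Letter.chi (mx.2 f) ≠ 0) :
    Design.mu (Design.fm s ε D) = s * ε ^ 4 * Design.mu D := by
  simp only [Design.mu, Design.fm, List.map_map, Function.comp_def]
  rw [← List.sum_map_mul_left]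
  congr 1
  refine List.map_congr_left fun mx hmx => ?_
  rw [Cell.top_fm, mul_div_assoc', div_eq_iff (Cell.R_ne_zero (hD mx hmx))]
  ring

/-- `μ̄` transforms the same way. -/
theorem Design.muBar_fm (s ε : K) {D : Design K} (hD : ∀ mx ∈ D, ∀ f, Letter.chi (mx.2 f) ≠ 0) :
    Design.muBar (Design.fm s ε D) = s * ε ^ 4 * Design.muBar D := by
  simp only [Design.muBar, Design.fm, List.map_map, Function.comp_def]
  rw [← List.sum_map_mul_left]
  congr 1
  refine List.map_congr_left fun mx hmx => ?_
  rw [Cell.topBar_fm, mul_div_assoc', div_eq_iff (Cell.R_ne_zero (hD mx hmx))]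
  ring

/-- `μ̂ ≠ 0 ↔ μ ≠ 0` for `s = ±1`, `ε = ±1`: FM neither creates nor kills the Weil charge. -/
theorem Design.mu_fm_ne_zero_iff {s ε : K} (hs : s ^ 2 = 1) (hε : ε ^ 2 = 1) {D : Design K}
    (hD : ∀ mx ∈ D, ∀ f, Letter.chi (mx.2 f) ≠ 0) :
    Design.mu (Design.fm s ε D) ≠ 0 ↔ Design.mu D ≠ 0 := by
  rw [Design.mu_fm s ε hD]
  have hs0 : s ≠ 0 := by intro h; rw [h] at hs; norm_num at hs
  have hε0 : ε ^ 4 ≠ 0 := by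
    have : ε ≠ 0 := by intro h; rw [h] at hε; norm_num at hε
    exact pow_ne_zero 4 this
  simp [hs0, hε0]

/-- Involution at design level on multiplicities: transforming twice multiplies `m` by `s²·R·R̂ = 1`. -/
theorem Design.rank_fm_fm {s ε : K} (hs : s ^ 2 = 1) (hε : ε ^ 2 = 1) {D : Design K}
    (hD : ∀ mx ∈ D, ∀ f, Letter.chi (mx.2 f) ≠ 0) :
    Design.rank (Design.fm s ε (Design.fm s ε D)) = Design.rank D := by
  rw [Design.rank_fm, Design.chi_fm hε hD, ← mul_assoc, ← sq, hs, one_mul]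

/-- The hub cell `(t·I)` in every factor: `e^{tH}` has transform `t⁸·e^{−H/t}` (rank `t⁸`, slope `−1/t`). -/
theorem Design.fm_hub (s ε : K) {t : K} (ht : t ≠ 0) :
    Design.fm s ε [((1 : K), fun _ => (t, 0, 0))] = [(s * t ^ 8, fun _ => (-1 / t, 0, 0))] := by
  simp only [Design.fm, List.map_cons, List.map_nil, List.cons.injEq, and_true, Prod.mk.injEq]
  refine ⟨?_, ?_⟩
  · simp only [Cell.R, Letter.chi, Finset.prod_const, Finset.card_univ, Fintype.card_fin]
    ring
  · funext f
    have ht2 : t ^ 2 - 0 * 0 ≠ 0 := by rw [mul_zero, sub_zero]; exact pow_ne_zero 2 ht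
    simp only [Cell.fm, Letter.fm, Letter.chi]
    refine Prod.ext ?_ (Prod.ext ?_ ?_)
    · show -t / (t ^ 2 - 0 * 0) = -1 / t
      rw [div_eq_div_iff ht2 ht]; ring
    · show ε * 0 / (t ^ 2 - 0 * 0) = 0
      rw [mul_zero, zero_div]
    · show ε * 0 / (t ^ 2 - 0 * 0) = 0
      rw [mul_zero, zero_div]

end Design

/-! ## Part C — LINE arithmetic and the degree reflection -/

section Arithmetic

/-- `χ(G(n'))` for a clean LINE class `γ − κH + μe⁴ + μ̄ē⁴` moved to LINE `n'`:
`∫ e^{n'H}(γ − κH) = γ n'⁸ − 8κ n'⁷` (`H⁸ = 8!·pt`, `H⁷·H = 8!·pt`; the Weil words integrate to `0` against `e^{n'H}`). -/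
def chiLine (n γ κ : ℤ) : ℤ := n ^ 7 * (γ * n - 8 * κ)

theorem chiLine_eq (n γ κ : ℤ) : chiLine n γ κ = γ * n ^ 8 - 8 * κ * n ^ 7 := by
  unfold chiLine; ring

/-- An FM partner of rank `< 128 = 2⁷` comes only from LINE `±1` (`γn' − 8κ` a non-zero integer). -/
theorem abs_le_one_of_chiLine_lt {n k : ℤ} (hk : k ≠ 0) (h : |n ^ 7 * k| < 128) : |n| ≤ 1 := by
  rcases le_or_gt |n| 1 with hle | hn
  · exact hle
  exfalso
  have h2 : (2 : ℤ) ≤ |n| := by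
    have := Int.add_one_le_iff.mpr hn
    linarith
  have hk1 : 1 ≤ |k| := Int.one_le_abs hk
  have h7 : (2 : ℤ) ^ 7 ≤ |n| ^ 7 := pow_le_pow_left₀ (by norm_num) h2 7
  rw [abs_mul, abs_pow] at h
  nlinarith

/-- Worked example ac808a66 (`γ = 4`, `κ_f = 1704`): the closed form of `χ(𝓔(tH))`. -/
theorem chiLine_ac808a66 (t : ℤ) :
    chiLine (14 + t) 4 1704 = (14 + t) ^ 7 * (4 * (14 + t) - 13632) := by
  unfold chiLine; ring

/-- ac808a66: `χ(𝓔(tH)) ≤ 0` on the whole window `−14 ≤ t ≤ 3394` — no IT₀ twist below `t = 3395`. -/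
theorem chiLine_ac808a66_nonpos {t : ℤ} (h1 : -14 ≤ t) (h2 : t ≤ 3394) :
    chiLine (14 + t) 4 1704 ≤ 0 := by
  rw [chiLine_ac808a66]
  exact mul_nonpos_iff.mpr (Or.inl ⟨pow_nonneg (by omega) 7, by omega⟩)

/-- ac808a66: the first positive value, `χ(𝓔(3395H)) = 4·3409⁷` (`≈ 2.1·10²⁵`), the least possible rank of a
locally free FM partner of `𝓔`; it lives on LINE `−1/3409`. -/
theorem chiLine_ac808a66_first : chiLine (14 + 3395) 4 1704 = 4 * 3409 ^ 7 := by
  unfold chiLine; norm_num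

theorem chiLine_ac808a66_first_val : chiLine (14 + 3395) 4 1704 = 21401735871485861713275076 := by
  unfold chiLine; norm_num

/-- LINE `−1` (`t = −15` for `h = 14`): every letter anti-ample, every cell IT₈; `χ = 8κ + γ`… here `13636`. -/
theorem chiLine_ac808a66_lineNegOne : chiLine (14 + (-15)) 4 1704 = 13636 := by
  unfold chiLine; norm_num

/-- LINE `1` (`t = −13`): `χ = γ − 8κ = −13628`. -/
theorem chiLine_ac808a66_lineOne : chiLine (14 + (-13)) 4 1704 = -13628 := by
  unfold chiLine; norm_num

/-- The ch-degree reflection `p ↦ 8 − p` of the transform on `X = S⁴` (`dim X = 8`). -/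
def fmDegree (p : ℕ) : ℕ := 8 - p

/-- The σ-form-degree reflection `k ↦ 6 − k` (`H^{k+2}(Ωᵏ) = H^{k,k+2} ↦ H^{6−k,8−k}`). -/
def fmFormDegree (k : ℕ) : ℕ := 6 - k

theorem fmDegree_invol {p : ℕ} (hp : p ≤ 8) : fmDegree (fmDegree p) = p := by
  unfold fmDegree; omega

theorem fmFormDegree_invol {k : ℕ} (hk : k ≤ 6) : fmFormDegree (fmFormDegree k) = k := by
  unfold fmFormDegree; omega

/-- The door slot `p = n = 4` is the unique FM-fixed ch-degree. -/
theorem fmDegree_fixed_iff {p : ℕ} (hp : p ≤ 8) : fmDegree p = p ↔ p = 4 := by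
  unfold fmDegree; omega

/-- Form degree `3` (`σ₃ : Ext² → H⁵(Ω³) = H^{3,5}`, the Bloch/BF component for a codimension-4 class) is the
unique FM-fixed σ-slot; the single slot of form degree `4` goes to form degree `2`. -/
theorem fmFormDegree_fixed_iff {k : ℕ} (hk : k ≤ 6) : fmFormDegree k = k ↔ k = 3 := by
  unfold fmFormDegree; omega

theorem fmFormDegree_four : fmFormDegree 4 = 2 := by
  unfold fmFormDegree; omega

/-- Hodge type `(p, q) ↦ (8 − q, 8 − p)`: Weil-type `(4,4)` classes stay in `(4,4)`, `σ`-targets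
`(k, k+2) ↦ (6−k, 8−k)`. -/
theorem hodgeType_reflect (k : ℕ) (hk : k ≤ 6) :
    8 - (k + 2) = fmFormDegree k ∧ 8 - k = fmFormDegree k + 2 := by
  unfold fmFormDegree; omega

end Arithmetic

end Summit.HodgeConjecture.HodgeConjecture.Cruxes.BlochSeedDiscOne.FourierMukaiLetterLaw
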